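import Literature.AlgebraicGeometry.AbelianSchemes.AbelianSchemeDualPairBaseChange
import HarnessLib

/-!
# Restriction (comap) of rigidified line bundles along a morphism of test schemes

Layer `Literature/AlgebraicGeometry/AbelianSchemes`, namespace `Literature.AlgebraicGeometry.AbelianSchemes.AbelianSchemeOver`.
For an abelian scheme `A/S`, `f : T ⟶ S`, a rigidified line bundle `ℒ` on `A_T = A ×_S T` (`RigidifiedLineBundle`,
the test objects of [MilneAV2008, I §8]) and a morphism of test schemes `u : T′ ⟶ T`:

* `AbelianSchemeOver.restrictLeft f u : A_{u ≫ f} ⟶ A_T` — the map `1_A × u` (through `bcHomLeft`), its two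
  projection squares and the square with `baseChangeToProd` (`(1 × u) ≫ (1 × g) = 1 × (u ≫ g)`);
* `RigidifiedLineBundle.pullbackBase ℒ u : (A_T).RigidifiedLineBundle u` — `ℒ` pulled back to `(A_T) ×_T T′`,
  rigidified by `unitSection_baseChange_comp_fst`;
* `RigidifiedLineBundle.comap ℒ u : A.RigidifiedLineBundle (u ≫ f)` — the same on `A_{u ≫ f}` (`alongBaseChange`), with
  `comapLIso : (ℒ.comap u).L ≅ (1_A × u)^* ℒ.L`;
* `FibrewisePicZero.pullbackBase`, `FibrewisePicZero.comap` — the fibrewise-`Pic⁰` condition restricts (the fibre of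
  `A_{T′}` at `t` is the fibre of `A_T` at `t ≫ u`, `fibreBaseChangeIso`).

This is the functoriality in `T` of the test data of [MumfordAV1970, §13] / [MilneAV2008, I §8] (used to localise the
universal property of the dual on the test scheme).  Everything is proved; definitions with bodies, no named facts.

## References
* [MilneAV2008] J. S. Milne, *Abelian Varieties* (v2.00, 2008), I §8 pp. 36–37.
* [MumfordAV1970] D. Mumford, *Abelian Varieties* (1970), §13 (p. 125).
* [GortzWedhorn2020] U. Görtz, T. Wedhorn, *Algebraic Geometry I*, 2nd ed. (2020), Section (4.7) (pp. 107–108), Remark 16.54 (p. 678).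
-/

universe u

open CategoryTheory CategoryTheory.Limits AlgebraicGeometry MonoidalCategory

noncomputable section

-- `Scheme.Modules` / `SheafOfModules` are not reducible (as in Mathlib's `AlgebraicGeometry/Modules/Sheaf.lean`).
set_option backward.isDefEq.respectTransparency false

namespace Literature.AlgebraicGeometry.AbelianSchemes

open Literature.AlgebraicGeometry.Motives Literature.AlgebraicGeometry.AbelianVarieties
  Literature.AlgebraicGeometry.Modules

namespace AbelianSchemeOver

variable {S T T' : Scheme.{u}} (A : AbelianSchemeOver S) (f : T ⟶ S) (u : T' ⟶ T)

/-! ### §1 `1_A × u : A_{u ≫ f} ⟶ A_T` -/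

/-- **`1_A × u : A_{u ≫ f} = A ×_S T′ ⟶ A ×_S T = A_T`** — through `A_{u ≫ f} ≅ (A_T)_{T′}` (★ `bcHomLeft`) followed by
the projection `(A_T) ×_T T′ → A_T` (non-Prop plumbing). [cite: GortzWedhorn2020, Section (4.7) (pp. 107–108)] -/
def restrictLeft : (A.baseChange (u ≫ f)).X.left ⟶ (A.baseChange f).X.left :=
  A.bcHomLeft f u ≫ pullback.fst (pullback.snd A.X.hom f) u

/-- `(1_A × u) ≫ pr_A = pr_A`. [cite: GortzWedhorn2020, Section (4.7) (pp. 107–108)] -/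
@[reassoc]
theorem restrictLeft_fst : A.restrictLeft f u ≫ pullback.fst A.X.hom f = pullback.fst A.X.hom (u ≫ f) := by
  rw [restrictLeft, Category.assoc]
  exact A.baseChangeCompGrpIso_hom_left_fst_fst f u

/-- `(1_A × u) ≫ pr_T = pr_{T′} ≫ u`. [cite: GortzWedhorn2020, Section (4.7) (pp. 107–108)] -/
@[reassoc]
theorem restrictLeft_snd :
    A.restrictLeft f u ≫ pullback.snd A.X.hom f = pullback.snd A.X.hom (u ≫ f) ≫ u := by
  rw [restrictLeft, Category.assoc, pullback.condition, ← Category.assoc, A.baseChangeCompGrpIso_hom_left_snd f u]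

/-- **`(1_A × u) ≫ (1_A × g) = 1_A × (u ≫ g)`** for an `S`-morphism `g : T → B` (the square with ★ `baseChangeToProd`).
[cite: MilneAV2008, I §8 pp. 36–37] -/
@[reassoc]
theorem restrictLeft_comp_baseChangeToProd (B : AbelianSchemeOver S) (g : T ⟶ B.X.left) (hg : g ≫ B.X.hom = f) :
    A.restrictLeft f u ≫ A.baseChangeToProd B f g hg =
      A.baseChangeToProd B (u ≫ f) (u ≫ g) (by rw [Category.assoc, hg]) := by
  apply pullback.hom_ext
  · rw [Category.assoc, baseChangeToProd_fst, baseChangeToProd_fst, restrictLeft_fst]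
  · rw [Category.assoc, baseChangeToProd_snd, baseChangeToProd_snd, restrictLeft_snd_assoc]

/-! ### §2 Restriction of rigidified line bundles -/

namespace RigidifiedLineBundle

variable {A} {f} (ℒ : A.RigidifiedLineBundle f)

/-- The pull-back of the unit module along any morphism of schemes is the unit module (Mathlib
`SheafOfModules.pullbackObjUnitToUnit`, an isomorphism since `Opens.map` is final — ★ `KTheory.final_opensMap`;
the ★ `rigid_PBaseChange` device). [folklore] -/
def pullbackUnitIso {X Y : Scheme.{u}} (v : X ⟶ Y) :
    (Scheme.Modules.pullback v).obj (SheafOfModules.unit _) ≅ SheafOfModules.unit _ :=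
  haveI : IsIso (SheafOfModules.pullbackObjUnitToUnit v.toRingCatSheafHom) := by
    haveI := Literature.AlgebraicGeometry.KTheory.final_opensMap v
    exact SheafOfModules.instIsIsoPullbackObjUnitToUnitOfFinal _
  asIso (SheafOfModules.pullbackObjUnitToUnit v.toRingCatSheafHom)

/-- **Restriction of `ℒ` along `u : T′ → T`, as a rigidified line bundle on `(A_T) ×_T T′` over `u`**: the module is
`pr^* ℒ`, the rigidification is `ε_{T′}^* pr^* ℒ ≅ u^* ε_T^* ℒ ≅ u^* 𝒪_T ≅ 𝒪_{T′}` (★ `unitSection_baseChange_comp_fst`: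
`ε_{(A_T)_{T′}} ≫ pr = u ≫ ε_{A_T}`). [cite: MilneAV2008, I §8 pp. 36–37] -/
def pullbackBase (u : T' ⟶ T) : (A.baseChange f).RigidifiedLineBundle u where
  L := (Scheme.Modules.pullback (pullback.fst (A.baseChange f).X.hom u)).obj ℒ.L
  hasRank_one := hasRank_pullback _ ℒ.hasRank_one
  rigid := ℒ.rigid.map fun r =>
    (Scheme.Modules.pullbackComp _ _).app ℒ.L ≪≫
      (Scheme.Modules.pullbackCongr ((A.baseChange f).unitSection_baseChange_comp_fst u)).app ℒ.L ≪≫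
      ((Scheme.Modules.pullbackComp _ _).app ℒ.L).symm ≪≫
      (Scheme.Modules.pullback u).mapIso r ≪≫ pullbackUnitIso u

/-- The module of `ℒ.pullbackBase u` is `pr^* ℒ` (definitional). [cite: MilneAV2008, I §8 pp. 36–37] -/
@[simp]
theorem pullbackBase_L (u : T' ⟶ T) :
    (ℒ.pullbackBase u).L = (Scheme.Modules.pullback (pullback.fst (A.baseChange f).X.hom u)).obj ℒ.L :=
  rfl

/-- **`ℒ.comap u` — restriction of `ℒ` along `u : T′ → T`, as a rigidified line bundle on `A_{u ≫ f}`**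
(★ `alongBaseChange` of `pullbackBase`). [cite: MilneAV2008, I §8 pp. 36–37] [cite: MumfordAV1970, §13 (p. 125)] -/
def comap (u : T' ⟶ T) : A.RigidifiedLineBundle (u ≫ f) :=
  (ℒ.pullbackBase u).alongBaseChange

/-- **The module of `ℒ.comap u` is `(1_A × u)^* ℒ`.** [cite: MilneAV2008, I §8 pp. 36–37] -/
def comapLIso (u : T' ⟶ T) :
    (ℒ.comap u).L ≅ (Scheme.Modules.pullback (A.restrictLeft f u)).obj ℒ.L :=
  (Scheme.Modules.pullbackComp _ _).app ℒ.L

/-! ### §3 The fibrewise-`Pic⁰` condition restricts -/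

variable {ℒ}

/-- `ℒ.pullbackBase u` is fibrewise in `Pic⁰` if `ℒ` is: the fibre of `(A_T)_{T′}` at `t` is the fibre of `A_T` at
`t ≫ u` (★ `fibreBaseChangeIso`). [cite: MumfordAV1970, §8 ((iv) ⇔ (i))] [cite: MilneAV2008, I §8 pp. 36–37] -/
theorem FibrewisePicZero.pullbackBase (h : ℒ.FibrewisePicZero) (u : T' ⟶ T) :
    (ℒ.pullbackBase u).FibrewisePicZero := by
  intro Ω _ _ t
  have h1 := (isHomogeneous_pullback_iff_of_iso ((A.baseChange f).fibreBaseChangeIso u t) _).2 (h Ω (t ≫ u))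
  refine (isHomogeneous_iff_of_iso _ ?_).1 h1
  -- `φ^* pr_{t ≫ u}^* ℒ ≅ (φ ≫ pr_{t ≫ u})^* ℒ = (pr_t ≫ pr_u)^* ℒ ≅ pr_t^* pr_u^* ℒ`
  exact (Scheme.Modules.pullbackComp _ _).app ℒ.L ≪≫
    (Scheme.Modules.pullbackCongr ((A.baseChange f).fibreBaseChangeIso_hom_toSchemeHom_fst u t)).app ℒ.L ≪≫
    ((Scheme.Modules.pullbackComp _ _).app ℒ.L).symm

/-- **`ℒ.comap u` is fibrewise in `Pic⁰` if `ℒ` is.** [cite: MumfordAV1970, §8 ((iv) ⇔ (i))] [cite: MilneAV2008, I §8 pp. 36–37] -/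
theorem FibrewisePicZero.comap (h : ℒ.FibrewisePicZero) (u : T' ⟶ T) : (ℒ.comap u).FibrewisePicZero :=
  alongBaseChange_fibrewisePicZero (h.pullbackBase u)

end RigidifiedLineBundle

end AbelianSchemeOver

end Literature.AlgebraicGeometry.AbelianSchemes

end
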